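import Summits.BirchSwinnertonDyer.BirchSwinnertonDyer.Theorems.AlignedTransportAtTwoMainConjectureOfRankZeroBSDAtTwoRankCertificateLambda
import Literature.NumberTheory.IwasawaTheory.ClassGroupCoinvariantGenusCriterionRank
import HarnessLib

/-!
# Route `AlignedTransportAtTwo`, crux C2 `MainConjectureOfRankZeroBSDAtTwo` (stmt-BirchSwinnertonDyer-22298):
# DOOR L12 IN ITS PRINTED (GENUS / RANK) FORMS IS VOID ON THE SEXTIC `ℚ(W[2])`, AND THE FIRST DOOR THAT COULD FIRE (`c = 3`) WOULD PIN `λ₂ = 3`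

HONEST FRAMING (cell `bsd-f1-sign2`, WIDTH-5 attached prover seat `bsd-line-att-p3` gen 28, line `birth`, lead `bsd-line-att-p2`; `--supports`
stmt-BirchSwinnertonDyer-22298, closes nothing; BSD is NOT proved; crux C2, its verdict «blocked-on `Rank1Residual.GreenbergMuConjectureIrreducible`» and every
registered stub untouched).  THEOREMS ONLY — no definition, no named fact, no `sorry`.  Third Summits file of this gen: `…SexticRankCertificate` (p757586) showed that
the coinvariant index bound `hco` (`c ≤ 1`) through which door L12 concludes is false on the sextic at every pair; this file says the same of the door's two
PRINTED hypotheses (genus-bound form `hgen` and rank form `k + t ≤ c + 1 + r` of `ClassGroupCoinvariantGenusCriterion`, cell bsd-2adic k4-w2 GEN 14), through this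
gen's rank-explicit Literature sequel `ClassGroupCoinvariantGenusCriterionRank` (door ⟹ `r_{n₀+k} ≤ c ∀ k`), and records what the first admissible coinvariant door
(`i = 2`, `c = 3`, pair `(T_{n+2}, T_{n+3})`) would give: all deep ranks `= 3` and `λ₂(ℚ(W[2])^{cyc}) = 3`.

* `pow_three_dvd_index_of_rankCert_zero_divisionField_two` — the `(0,1)` certificate in `Cl(ℚ(W[2]))` currency: `r_1 = r_0 ⟹ 2³ ∣ [Cl(ℚ(W[2])) : Cl²]`;
  contrapositive `classGroupPRank_one_ne_zero_of_index_le_four_divisionField_two` (`[Cl : Cl²] ≤ 4` ⟹ no `(0,1)` certificate);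
* `not_genus_bound_layer_succ_succ_divisionField_two` — for every Fukuda index `n₀` and `c ≤ 1`:
  `¬ ([Cl(T_{n₀+1}) : Cl²] · ∏ e_𝔓(T_{n₀+2}/T_{n₀+1}) ≤ 2^c · 2 · [E : E ∩ N])`;
* `not_rank_add_le_layer_succ_succ_divisionField_two` — with `[Cl(T_{n₀+1}):Cl²] ≤ 2^k`, `2^r ∣ [E:E∩N]`: `¬ (k + t ≤ c + 1 + r)` (`c ≤ 1`);
* `classGroupPRank_eq_three_of_coinvariant_index_le_divisionField_two` / `classicalLambda_eq_three_of_coinvariant_index_le_divisionField_two` — a coinvariant index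
  `≤ 2^3` at `(n+2, n+3)` forces `rank₂ Cl(T_m) = 3` for every `m ≥ max(n, 2)` and `λ₂ = 3`.

References: [Washington1997] §13.3 Prop. 13.22–13.23, Thm. 13.13; [Fukuda1994] Thm. 1 (2); [Gras2003] IV.4; [Lang1990] Ch. 13 §4 L4.1.
-/

set_option linter.dupNamespace false
set_option autoImplicit false

noncomputable section
open scoped Classical NumberField nonZeroDivisors
namespace Summit.BirchSwinnertonDyer.BirchSwinnertonDyer.Theorems.AlignedTransportAtTwoSexticGenusDoor

open NumberField IsDedekindDomain WeierstrassCurve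
open Literature.NumberTheory.EllipticCurves.Greenberg1999 Summit.BirchSwinnertonDyer.Rank1Residual.F1Sign2
open Literature.NumberTheory.NumberFields Literature.NumberTheory.GaloisRepresentations Literature.NumberTheory.GaloisRepresentations.Herbrand
  Literature.NumberTheory.GaloisRepresentations.MinkowskiUnit Literature.NumberTheory.GaloisRepresentations.CyclicNormIndex
  Literature.NumberTheory.IwasawaTheory Literature.NumberTheory.EllipticCurves
  Summit.BirchSwinnertonDyer.BirchSwinnertonDyer.Theorems.AlignedTransportAtTwoSexticTowerLambda
  Summit.BirchSwinnertonDyer.BirchSwinnertonDyer.Theorems.AlignedTransportAtTwoSexticTowerRank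
  Summit.BirchSwinnertonDyer.BirchSwinnertonDyer.Theorems.AlignedTransportAtTwoSexticRankCertificate
  Summit.BirchSwinnertonDyer.BirchSwinnertonDyer.Theorems.AlignedTransportAtTwoRankCertificateLambda

section Sextic

open Summit.BirchSwinnertonDyer.BirchSwinnertonDyer.Theorems.AlignedTransportAtTwoKilfordStratumShared

variable (W : WeierstrassCurve ℚ) [W.IsElliptic]

/-- ★ **The `(0,1)` certificate in `Cl(ℚ(W[2]))` currency**: if `rank₂ Cl(ℚ(W[2])(√2)) = rank₂ Cl(ℚ(W[2]))` along a cyclotomic `ℤ₂`-extension then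
**`2³ ∣ [Cl(ℚ(W[2])) : Cl(ℚ(W[2]))²]`** — the class group of the sextic itself (degree `6`) has `2`-rank `≥ 3` (p757586 `three_le_classGroupPRank_zero_of_rankCert_zero`
read through the dictionary `classGroupPRank_zero_eq`).  The census datum is `Cl(ℚ(W[2]))/2`. [cite: Fukuda1994, Thm. 1 (2), p. 264] [cite: Gras2003, IV.4]
[cite: Lang1990, Ch. 13 §2] -/
theorem pow_three_dvd_index_of_rankCert_zero_divisionField_two (ht : ∀ x : ℚ, ¬ HasRationalTwoTorsionX W x) (hΔ : W.Δ < 0)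
    (hs : OnKilfordStratumAtTwo W) (κ : ZpExtension (W.divisionField 2) 2) (hκ : κ.IsCyclotomic)
    (hcert : classGroupPRank κ 1 = classGroupPRank κ 0) :
    haveI : NumberField (W.divisionField 2) := NumberField.mk
    2 ^ 3 ∣ (powMonoidHom 2 : ClassGroup (𝓞 (W.divisionField 2)) →* ClassGroup (𝓞 (W.divisionField 2))).range.index := by
  haveI : NumberField (W.divisionField 2) := NumberField.mk
  haveI : Fact (Nat.Prime 2) := ⟨Nat.prime_two⟩
  have h3 := three_le_classGroupPRank_zero_of_rankCert_zero W ht hΔ hs κ hκ hcert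
  rw [classGroupPRank_zero_eq] at h3
  obtain ⟨c, hc⟩ := index_range_powMonoidHom_eq_prime_pow (K := W.divisionField 2) 2
  rw [hc, padicValNat.prime_pow] at h3
  rw [hc]
  exact pow_dvd_pow 2 h3

/-- Contrapositive for the census: **`[Cl(ℚ(W[2])) : Cl²] ≤ 4` (2-rank `≤ 2`) ⟹ no `(0,1)` certificate**, `rank₂ Cl(ℚ(W[2])(√2)) ≠ rank₂ Cl(ℚ(W[2]))`.
[cite: Fukuda1994, Thm. 1 (2), p. 264] [cite: Gras2003, IV.4] -/
theorem classGroupPRank_one_ne_zero_of_index_le_four_divisionField_two (ht : ∀ x : ℚ, ¬ HasRationalTwoTorsionX W x) (hΔ : W.Δ < 0)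
    (hs : OnKilfordStratumAtTwo W) (κ : ZpExtension (W.divisionField 2) 2) (hκ : κ.IsCyclotomic)
    (h4 : haveI : NumberField (W.divisionField 2) := NumberField.mk
      (powMonoidHom 2 : ClassGroup (𝓞 (W.divisionField 2)) →* ClassGroup (𝓞 (W.divisionField 2))).range.index ≤ 4) :
    classGroupPRank κ 1 ≠ classGroupPRank κ 0 := fun hcert ↦ by
  haveI : NumberField (W.divisionField 2) := NumberField.mk
  have h8 := Nat.le_of_dvd (Nat.pos_of_ne_zero Subgroup.index_ne_zero_of_finite)
    (pow_three_dvd_index_of_rankCert_zero_divisionField_two W ht hΔ hs κ hκ hcert)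
  omega

/-- **Door L12, genus-bound form, is VOID on the sextic.**  `W` with no rational `2`-torsion abscissa, `Δ_W < 0`, ON the Kilford stratum; `κ` any cyclotomic
`ℤ₂`-extension of `T = ℚ(W[2])`; `n₀` arbitrary, `c ≤ 1`.  The printed hypothesis `[Cl(T_{n₀+1}) : Cl²] · ∏_𝔓 e_𝔓(T_{n₀+2}/T_{n₀+1}) ≤ 2^c · 2 · [E : E ∩ N]` of
`classicalMuVanishes_of_genus_bound_layer_succ_succ` FAILS: it would give `rank₂ Cl(T_{n₀+2}) ≤ c ≤ 1` (`classGroupPRank_le_of_genus_bound_layer_succ_succ`) against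
`≥ 3`. [cite: Washington1997, §13.3 Prop. 13.22–13.23] [cite: Lang1990, Ch. 13 §4, Lemma 4.1 (PDF p. 203)] [cite: Gras2003, IV.4] -/
theorem not_genus_bound_layer_succ_succ_divisionField_two (ht : ∀ x : ℚ, ¬ HasRationalTwoTorsionX W x) (hΔ : W.Δ < 0)
    (hs : OnKilfordStratumAtTwo W) (κ : ZpExtension (W.divisionField 2) 2) (hκ : κ.IsCyclotomic) (n₀ : ℕ)
    [NumberField (κ.layer (n₀ + 1))] [NumberField (κ.layer (n₀ + (1 + 1)))] {c : ℕ} (hc : c ≤ 1) :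
    ¬ (letI : Algebra (κ.layer (n₀ + 1)) (κ.layer (n₀ + (1 + 1))) :=
        (IntermediateField.inclusion (κ.layer_mono (by omega))).toRingHom.toAlgebra
      (powMonoidHom 2 : ClassGroup (𝓞 (κ.layer (n₀ + 1))) →* ClassGroup (𝓞 (κ.layer (n₀ + 1)))).range.index *
          (∏ᶠ v : HeightOneSpectrum (𝓞 (κ.layer (n₀ + 1))), v.asIdeal.ramificationIdxIn (𝓞 (κ.layer (n₀ + (1 + 1))))) ≤
        2 ^ c * 2 * (unitsE (κ.layer (n₀ + (1 + 1))) ⊓ (⊤ : Subgroup (κ.layer (n₀ + (1 + 1)))ˣ).map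
            (Herbrand.norm ((κ.layer (n₀ + (1 + 1))) ≃ₐ[κ.layer (n₀ + 1)] (κ.layer (n₀ + (1 + 1)))))).relIndex
          (unitsE (κ.layer (n₀ + (1 + 1))) ⊓ (unitsIncl (κ.layer (n₀ + 1)) (κ.layer (n₀ + (1 + 1)))).range)) := by
  haveI : NumberField (W.divisionField 2) := NumberField.mk
  haveI : Fact (Nat.Prime 2) := ⟨Nat.prime_two⟩
  intro hgen
  have hram : TotallyRamifiedFrom κ n₀ := (totallyRamifiedFrom_zero_divisionField_two W ht hΔ hs κ hκ).mono (Nat.zero_le n₀)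
  have hc' : c ≤ 2 - 1 := by omega
  have hrank := classGroupPRank_le_of_genus_bound_layer_succ_succ κ hram hc' hgen 2
  have h3 := three_le_classGroupPRank_layer_divisionField_two W ht hΔ hs κ hκ (n := n₀ + 2) (by omega)
  omega

/-- **Door L12, rank form, is VOID on the sextic**: with `[Cl(T_{n₀+1}) : Cl²] ≤ 2^k` and `2^r ∣ [E_{T_{n₀+1}} : E ∩ N_{T_{n₀+2}/T_{n₀+1}}]`, the printed numerical hypothesis
`k + t ≤ c + 1 + r` (`t` = primes of `T_{n₀+1}` ramified in `T_{n₀+2}`, `c ≤ 1`) of `classicalMuVanishes_of_rank_add_le_layer_succ_succ` FAILS for every `n₀`.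
[cite: Washington1997, §13.3 Prop. 13.23] [cite: Gras2003, IV.4] -/
theorem not_rank_add_le_layer_succ_succ_divisionField_two (ht : ∀ x : ℚ, ¬ HasRationalTwoTorsionX W x) (hΔ : W.Δ < 0)
    (hs : OnKilfordStratumAtTwo W) (κ : ZpExtension (W.divisionField 2) 2) (hκ : κ.IsCyclotomic) (n₀ : ℕ)
    [NumberField (κ.layer (n₀ + 1))] [NumberField (κ.layer (n₀ + (1 + 1)))] {c k r : ℕ} (hc : c ≤ 1)
    (hk : (powMonoidHom 2 : ClassGroup (𝓞 (κ.layer (n₀ + 1))) →* ClassGroup (𝓞 (κ.layer (n₀ + 1)))).range.index ≤ 2 ^ k)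
    (hr : letI : Algebra (κ.layer (n₀ + 1)) (κ.layer (n₀ + (1 + 1))) :=
        (IntermediateField.inclusion (κ.layer_mono (by omega))).toRingHom.toAlgebra
      2 ^ r ∣ (unitsE (κ.layer (n₀ + (1 + 1))) ⊓ (⊤ : Subgroup (κ.layer (n₀ + (1 + 1)))ˣ).map
            (Herbrand.norm ((κ.layer (n₀ + (1 + 1))) ≃ₐ[κ.layer (n₀ + 1)] (κ.layer (n₀ + (1 + 1)))))).relIndex
          (unitsE (κ.layer (n₀ + (1 + 1))) ⊓ (unitsIncl (κ.layer (n₀ + 1)) (κ.layer (n₀ + (1 + 1)))).range)) :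
    letI : Algebra (κ.layer (n₀ + 1)) (κ.layer (n₀ + (1 + 1))) :=
        (IntermediateField.inclusion (κ.layer_mono (by omega))).toRingHom.toAlgebra
    ¬ k + {v : HeightOneSpectrum (𝓞 (κ.layer (n₀ + 1))) |
        v.asIdeal.ramificationIdxIn (𝓞 (κ.layer (n₀ + (1 + 1)))) ≠ 1}.ncard ≤ c + 1 + r := by
  haveI : NumberField (W.divisionField 2) := NumberField.mk
  haveI : Fact (Nat.Prime 2) := ⟨Nat.prime_two⟩
  have hram : TotallyRamifiedFrom κ n₀ := (totallyRamifiedFrom_zero_divisionField_two W ht hΔ hs κ hκ).mono (Nat.zero_le n₀)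
  have hc' : c ≤ 2 - 1 := by omega
  have h3 := three_le_classGroupPRank_layer_divisionField_two W ht hΔ hs κ hκ (n := n₀ + 2) (by omega)
  exact not_rank_add_le_of_lt_classGroupPRank κ hram hc' hk hr (j := 2) (by omega)

/-- **The first admissible coinvariant door pins everything**: a coinvariant index `≤ 2^3` at the pair `(T_{n+2}, T_{n+3})` (`i = 2`, `c = 3 < 4`) gives
`rank₂ Cl(T_m) ≤ 3` for all `m ≥ n` (tree), hence **`rank₂ Cl(T_m) = 3` for every `m ≥ max(n, 2)`**. [cite: Washington1997, §13.3 Prop. 13.22–13.23] [cite: Gras2003, IV.4] -/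
theorem classGroupPRank_eq_three_of_coinvariant_index_le_divisionField_two (ht : ∀ x : ℚ, ¬ HasRationalTwoTorsionX W x) (hΔ : W.Δ < 0)
    (hs : OnKilfordStratumAtTwo W) (κ : ZpExtension (W.divisionField 2) 2) (hκ : κ.IsCyclotomic) {n : ℕ}
    (hco : haveI : NumberField (W.divisionField 2) := NumberField.mk
      ((powMonoidHom 2 : ClassGroup (𝓞 (κ.layer (n + (2 + 1)))) →* ClassGroup (𝓞 (κ.layer (n + (2 + 1))))).range ⊔
        Subgroup.closure {x | ∃ (σ : (κ.layer (n + (2 + 1))) ≃ₐ[W.divisionField 2] (κ.layer (n + (2 + 1))))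
          (_ : ∀ y : κ.layer (n + (2 + 1)), ((y : κ.layer (n + (2 + 1))) : AlgebraicClosure (W.divisionField 2)) ∈ κ.layer (n + 2) → σ y = y)
          (x' : ClassGroup (𝓞 (κ.layer (n + (2 + 1))))), x = ClassGroup.mulEquiv (AmbiguousClass.intAut σ) x' * x'⁻¹}).index ≤ 2 ^ 3)
    {m : ℕ} (hnm : n ≤ m) (h2m : 2 ≤ m) : classGroupPRank κ m = 3 := by
  haveI : NumberField (W.divisionField 2) := NumberField.mk
  haveI : Fact (Nat.Prime 2) := ⟨Nat.prime_two⟩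
  have hram := totallyRamifiedFrom_zero_divisionField_two W ht hΔ hs κ hκ
  obtain ⟨k, rfl⟩ : ∃ k, m = n + k := ⟨m - n, by omega⟩
  have hle := classGroupPRank_le_of_coinvariant_index_le κ hram (Nat.zero_le n) (i := 2) (c := 3) (by norm_num) hco k
  have hge := three_le_classGroupPRank_layer_divisionField_two W ht hΔ hs κ hκ (n := n + k) h2m
  omega

/-- … **and `λ₂(ℚ(W[2])^{cyc}) = 3`** (`3 ≤ λ ≤ c = 3`, p758617). [cite: Washington1997, §13.3 Thm. 13.13] [cite: Fukuda1994, Thm. 1 (2), p. 264] -/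
theorem classicalLambda_eq_three_of_coinvariant_index_le_divisionField_two (ht : ∀ x : ℚ, ¬ HasRationalTwoTorsionX W x) (hΔ : W.Δ < 0)
    (hs : OnKilfordStratumAtTwo W) (κ : ZpExtension (W.divisionField 2) 2) (hκ : κ.IsCyclotomic) {n : ℕ}
    (hco : haveI : NumberField (W.divisionField 2) := NumberField.mk
      ((powMonoidHom 2 : ClassGroup (𝓞 (κ.layer (n + (2 + 1)))) →* ClassGroup (𝓞 (κ.layer (n + (2 + 1))))).range ⊔
        Subgroup.closure {x | ∃ (σ : (κ.layer (n + (2 + 1))) ≃ₐ[W.divisionField 2] (κ.layer (n + (2 + 1))))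
          (_ : ∀ y : κ.layer (n + (2 + 1)), ((y : κ.layer (n + (2 + 1))) : AlgebraicClosure (W.divisionField 2)) ∈ κ.layer (n + 2) → σ y = y)
          (x' : ClassGroup (𝓞 (κ.layer (n + (2 + 1))))), x = ClassGroup.mulEquiv (AmbiguousClass.intAut σ) x' * x'⁻¹}).index ≤ 2 ^ 3) :
    classicalLambda κ = 3 := by
  obtain ⟨-, hge, hle⟩ := three_le_classicalLambda_and_le_of_coinvariant_index_le_divisionField_two W ht hΔ hs κ hκ (i := 2) (c := 3) (by norm_num) hco
  omega

variable [W.IsGloballyMinimal]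

/-- The `Δ_min ≡ 1 (mod 8)` form (globally minimal `W`, good ordinary at `2`) of «door L12, genus form, is void». [cite: Washington1997, §13.3 Prop. 13.22–13.23]
[cite: Serre1973, Ch. II §3.3 Thm. 4] -/
theorem not_genus_bound_layer_succ_succ_divisionField_two_of_minimalDiscriminantInt_emod_eight (hord : IsOrdinaryAt W 2)
    (ht : ∀ x : ℚ, ¬ HasRationalTwoTorsionX W x) (hΔ : W.Δ < 0) (h8 : minimalDiscriminantInt W % 8 = 1)
    (κ : ZpExtension (W.divisionField 2) 2) (hκ : κ.IsCyclotomic) (n₀ : ℕ)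
    [NumberField (κ.layer (n₀ + 1))] [NumberField (κ.layer (n₀ + (1 + 1)))] {c : ℕ} (hc : c ≤ 1) :
    ¬ (letI : Algebra (κ.layer (n₀ + 1)) (κ.layer (n₀ + (1 + 1))) :=
        (IntermediateField.inclusion (κ.layer_mono (by omega))).toRingHom.toAlgebra
      (powMonoidHom 2 : ClassGroup (𝓞 (κ.layer (n₀ + 1))) →* ClassGroup (𝓞 (κ.layer (n₀ + 1)))).range.index *
          (∏ᶠ v : HeightOneSpectrum (𝓞 (κ.layer (n₀ + 1))), v.asIdeal.ramificationIdxIn (𝓞 (κ.layer (n₀ + (1 + 1))))) ≤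
        2 ^ c * 2 * (unitsE (κ.layer (n₀ + (1 + 1))) ⊓ (⊤ : Subgroup (κ.layer (n₀ + (1 + 1)))ˣ).map
            (Herbrand.norm ((κ.layer (n₀ + (1 + 1))) ≃ₐ[κ.layer (n₀ + 1)] (κ.layer (n₀ + (1 + 1)))))).relIndex
          (unitsE (κ.layer (n₀ + (1 + 1))) ⊓ (unitsIncl (κ.layer (n₀ + 1)) (κ.layer (n₀ + (1 + 1)))).range)) :=
  not_genus_bound_layer_succ_succ_divisionField_two W ht hΔ ((onKilfordStratumAtTwo_iff_minimalDiscriminantInt_emod_eight W hord).mpr h8) κ hκ n₀ hc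

end Sextic

end Summit.BirchSwinnertonDyer.BirchSwinnertonDyer.Theorems.AlignedTransportAtTwoSexticGenusDoor
end
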